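import Summits.QuantumFields.YangMills.Theorems.ParabolicTrajectoryLatticeGapOnTrajectoryTrisectionGap
import Summits.QuantumFields.YangMills.Theorems.ContinuumLimitOnTrajectory.Negative.ContinuumLimitOnTrajectoryFalseOfKernelScaleBlowUp

/-!
# Line `regime-trisection` — crux `ContinuumLimitOnTrajectory` (stmt-QuantumFields-10522) — skeleton v3 (lead seat c12, 2026-08-17): child U re-typed in GAP CURRENCY

v3 = v2 (seat c8, sha 04ff2c9b; stubs V / I / U = the three children of the crux-strategist's split, landed in
`Theorems/ParabolicTrajectoryContinuumLimitOnTrajectoryRegimeTrisection.lean`, p152397) with ONE reshaped stub: the ultraviolet child is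
now `Stub.UltravioletLimitWithGapOnTrajectory : TrisectionGap.UltravioletLimitWithGapOnTrajectory` — child U VERBATIM with the conjunct
`∃ Δ₁ > 0, T.HasMassGap Δ₁` appended to its conclusion (the continuum gap of the SAME canonical witness), as typed and landed by the
(B)-chain lead (stmt-QuantumFields-10523 seat c9, `Theorems/ParabolicTrajectoryLatticeGapOnTrajectoryTrisectionGap.lean`, p158954,
cross-crux evidence `CROSS-CRUX-c9.md` on this item 2026-08-17T12:03Z). WHY the (A) chain adopts it (seat c12): (i) it costs the (A) side
nothing — U_gap is closed modulo the SAME two named UV statements as U (`TrisectionGap.ultravioletLimitWithGapOnTrajectory_of_inputs :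
ChartExists → UVPhysics345 → U_gap`, the landed `reductionUV` with the gap kept in its last line) and U_gap → U
(`TrisectionGap.ultravioletLimitOnTrajectory_of_withGap`), so the composition below still concludes (A) BY NAME through the landed split
glue; (ii) it is what makes the rev-8 deciding theorem independent of (B) AS FILED: with U as typed the only glue to `YangMills` is
`RegimeTrisection.yangMills_of_subs`, which feeds the canonical (non-reflection-symmetric) witness of U to (B)'s unrestricted transfer
clause `∀ sch' ~ sch, ∀ T, IsYangMillsFor r sch' T → T.HasMassGap Δ` — residual (α) of the (B) chain, certified underivable by its 13
leads — whereas with U_gap the route closes through `TrisectionGap.yangMills_of_trisectionGap : U_gap → I → Split.LatticeGapOnTrajectoryLat →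
TunedSequenceExistsPVG → YangMills` ((B) entering only as a pure-lattice statement; = seat c5's `yangMills_of_gapCurrency`, p145719, in
trisection clothing). So BOTH chains now file ONE children list for `--split ContinuumLimitOnTrajectory`: V (quarantined artefact, to be
dropped with the parent), I (infrared bridge), U_gap (the ultraviolet crux); `--glue-by` = `ContinuumLimitOnTrajectory_of` below
(= `SplitDefeqCheckB.glue_by_gap` of the (B) crux dir, rc 0 in route context).

Status of the stubs (unchanged in substance since c8; ninth concurring seat): V QUARANTINED (false modulo one slow-volume admissible
scheme — the torus-seam misstatement of (A) as typed, `Negative.continuumLimitOnTrajectory_false_of_kernelScaleBlowUp` p142608; NOT a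
prover target); I item-sized (crux (B)'s deliverable in Cauchy–Schwarz currency); U_gap item-sized (closed modulo `ChartExists`, PROMOTED
2026-08-16, and `UVPhysics345`, shared with stmt-QuantumFields-15828). wave: none — 0 delegable stubs. Disproof used: gen 3 §1
`not_crux_imp_gappedAFSequence` / `crux_of_no_gappedAFSequence` (neither junk direction), `not_withoutAF_unconditional` (U_gap keeps
`β_k → ∞`, `θ > 0`).
-/

set_option autoImplicit false

open scoped SchwartzMap
open MeasureTheory Filter Topology
open Literature.MathematicalPhysics.QuantumFieldTheory Literature.MathematicalPhysics.QuantumLattice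
open Literature.MathematicalPhysics.AQFT Literature.Probability.LatticeModels
open Summit.QuantumFields.YangMills.Theses.ParabolicTrajectory
open Summit.QuantumFields.YangMills.Cruxes.ContinuumLimitOnTrajectory.TwoOrbitSynchronisation
open Summit.QuantumFields.YangMills.Cruxes.LatticeGapOnTrajectory (TrisectionGap.UltravioletLimitWithGapOnTrajectory
  TrisectionGap.ultravioletLimitOnTrajectory_of_withGap TrisectionGap.ultravioletLimitWithGapOnTrajectory_of_inputs
  TrisectionGap.ultravioletLimitWithGapOnTrajectory_of_withGapPVG)

noncomputable section

namespace Summit.QuantumFields.YangMills.Cruxes.ContinuumLimitOnTrajectory.RegimeTrisection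

/-! ## §1 Registered stubs (V, I: defs in `…RegimeTrisection`; U_gap: def in `…TrisectionGap`)

Named `Stub.<ChildDecl>` (the skeleton audit admits a `Prop` hypothesis of the composition iff its head constant's short
name is a declared stub). -/

namespace Stub

/-- **stub V** — the artefact child (QUARANTINED: carries the misstatement of (A) as typed; not a prover target). -/
theorem ForcedVolumeGrowth : RegimeTrisection.ForcedVolumeGrowth := by
  sorry

/-- **stub I** — the infrared bridge (crux (B)'s deliverables in Cauchy–Schwarz currency; item-sized open physics). -/
theorem ClusteringOnTrajectory : RegimeTrisection.ClusteringOnTrajectory := by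
  sorry

/-- **stub U_gap** — the pure ultraviolet crux IN GAP CURRENCY (item-sized; closed modulo `ChartExists` + `UVPhysics345` by
the landed `TrisectionGap.ultravioletLimitWithGapOnTrajectory_of_inputs`: its own two-stub skeleton is
`ultravioletLimitWithGapOnTrajectory_of_inputs stub_chart stub_uv`). -/
theorem UltravioletLimitWithGapOnTrajectory : TrisectionGap.UltravioletLimitWithGapOnTrajectory := by
  sorry

end Stub

/-! ## §2 The composition concluding the crux BY NAME (= landed split glue ∘ landed `U_gap → U`) -/

/-- **The crux BY NAME from the three registered stubs**: `ContinuumLimitOnTrajectory_of_subs hV hI (U_gap → U)`; this is the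
`--glue-by` term for the children list (V, I, U_gap). -/
theorem ContinuumLimitOnTrajectory_of :
    ForcedVolumeGrowth → ClusteringOnTrajectory → TrisectionGap.UltravioletLimitWithGapOnTrajectory →
      ContinuumLimitOnTrajectory :=
  fun hV hI hU => ContinuumLimitOnTrajectory_of_subs hV hI (TrisectionGap.ultravioletLimitOnTrajectory_of_withGap hU)

/-- The skeleton's composition applied to its stubs (NOT closed: three `sorry`s). -/
theorem continuumLimitOnTrajectory_skeleton : ContinuumLimitOnTrajectory :=
  ContinuumLimitOnTrajectory_of Stub.ForcedVolumeGrowth Stub.ClusteringOnTrajectory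
    Stub.UltravioletLimitWithGapOnTrajectory

/-- The RECOMMENDED restatement (A_PVG) needs only the two honest stubs. -/
theorem continuumLimitOnTrajectoryPVG_skeleton : ContinuumLimitOnTrajectoryPVG :=
  continuumLimitOnTrajectoryPVG_of_subs Stub.ClusteringOnTrajectory
    (TrisectionGap.ultravioletLimitOnTrajectory_of_withGap Stub.UltravioletLimitWithGapOnTrajectory)

/-- Stub U_gap is closed modulo exactly the two named UV statements (landed, p158954) — recorded here so the skeleton shows the
hand-back target of `promote-stub`. -/
theorem stub_ugap_of_inputs : ChartExists → UVPhysics345 → TrisectionGap.UltravioletLimitWithGapOnTrajectory :=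
  TrisectionGap.ultravioletLimitWithGapOnTrajectory_of_inputs

/-- The (A) chain's earlier global gap-currency restatement `ContinuumLimitWithGapPVG` (…DefsF, seat c4/c5) implies stub U_gap
(landed read-back), so nothing certified for it is lost. -/
theorem stub_ugap_of_withGapPVG : ContinuumLimitWithGapPVG → TrisectionGap.UltravioletLimitWithGapOnTrajectory :=
  TrisectionGap.ultravioletLimitWithGapOnTrajectory_of_withGapPVG

/-! ## §3 Route-item read-back: the children one-liners ARE the registered stub statements (definitional) -/

namespace Child

/-- children entry 1 (`decl_name: ForcedVolumeGrowth`, kind support/quarantined), verbatim (unchanged from c8's `children.json`). -/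
def ForcedVolumeGrowth : Prop :=
  open Literature.MathematicalPhysics.QuantumFieldTheory Literature.MathematicalPhysics.QuantumLattice Literature.MathematicalPhysics.AQFT Classical in ∀ (G : Type) [Group G] [TopologicalSpace G] [IsTopologicalGroup G] [CompactSpace G] [MeasurableSpace G] [BorelSpace G], IsCompactSimpleLieGroup G → ∀ (r : LatticeRep G) (M : ℕ) (θ Δ : ℝ) (sch : SpeciesScheme (YMSpecies G)) (n : ℕ → ℕ), 0 < θ → 0 < Δ → (∀ k, sch.a k = ((M : ℝ) ^ n k)⁻¹) → Filter.Tendsto sch.β Filter.atTop Filter.atTop → (∀ t : ℕ, 0 < t → ∃ c : ℝ, Filter.Tendsto (fun k => ((M : ℝ) ^ n k) ^ 8 * latticeConnectedCorr r.ρ (sch.β k) (sch.side k) r.curvature.F r.curvature.F (t * M ^ n k)) Filter.atTop (nhds c)) → Filter.Tendsto (fun k => ((M : ℝ) ^ n k) ^ 8 * latticeConnectedCorr r.ρ (sch.β k) (sch.side k) r.curvature.F r.curvature.F (M ^ n k)) Filter.atTop (nhds θ) → HasLatticeMassGap r sch Δ → ∃ N : ℕ, 1 ≤ N ∧ ∀ᶠ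 k in Filter.atTop, (sch.a k)⁻¹ ≤ (sch.a k * (sch.L k : ℝ)) ^ N

/-- children entry 2 (`decl_name: ClusteringOnTrajectory`, kind crux), verbatim (unchanged from c8's `children.json`). -/
def ClusteringOnTrajectory : Prop :=
  open Literature.MathematicalPhysics.QuantumFieldTheory Literature.MathematicalPhysics.QuantumLattice Literature.MathematicalPhysics.AQFT Classical in ∀ (G : Type) [Group G] [TopologicalSpace G] [IsTopologicalGroup G] [CompactSpace G] [MeasurableSpace G] [BorelSpace G], IsCompactSimpleLieGroup G → ∀ (r : LatticeRep G) (M : ℕ) (θ Δ : ℝ) (sch : SpeciesScheme (YMSpecies G)) (n : ℕ → ℕ), 0 < θ → 0 < Δ → (∀ k, sch.a k = ((M : ℝ) ^ n k)⁻¹) → Filter.Tendsto sch.β Filter.atTop Filter.atTop → (∀ t : ℕ, 0 < t → ∃ c : ℝ, Filter.Tendsto (fun k => ((M : ℝ) ^ n k) ^ 8 * latticeConnectedCorr r.ρ (sch.β k) (sch.side k) r.curvature.F r.curvature.F (t * M ^ n k)) Filter.atTop (nhds c)) → Filter.Tendsto (fun k => ((M : ℝ) ^ n k) ^ 8 * latticeConnectedCorr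 r.ρ (sch.β k) (sch.side k) r.curvature.F r.curvature.F (M ^ n k)) Filter.atTop (nhds θ) → HasLatticeMassGap r sch Δ → (∃ N : ℕ, 1 ≤ N ∧ ∀ᶠ k in Filter.atTop, (sch.a k)⁻¹ ≤ (sch.a k * (sch.L k : ℝ)) ^ N) → let cn : SpeciesScheme (YMSpecies G) := { a := sch.a, a_pos := sch.a_pos, tendsto_a := sch.tendsto_a, β := sch.β, L := sch.L, tendsto_L := sch.tendsto_L, c := fun s k => if s = r.curvature then ((sch.a k) ^ 4)⁻¹ else 0, m := fun s k => wilsonTorusMean r.ρ (sch.β k) (sch.L k) s.F }; ((∀ (p : ℕ) (f : Fin p → SchwartzMap (EuclideanSpace ℝ (Fin 4)) ℝ), IsOffDiagonal (SchwartzMap.tensorFin p fun i => ofRealTest (f i)) → ∀ ε : ℝ, 0 < ε → ∀ᶠ k in Filter.atTop, ∀ L : ℕ, sch.L k ≤ L → |latticeSchwinger r.ρ cn (fun s => s.F) k p (fun _ => r.curvature) f - wilsonCentredSchwinger r.ρ (sch.β k) L (fun _ => 1) p (fun _ => r.curvature) (fun i => (blockDilate M)^[n k] (f i))| ≤ ε)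 ∧ (∀ t : ℕ, 0 < t → ∀ ε : ℝ, 0 < ε → ∀ᶠ k in Filter.atTop, ∀ S : ℕ, sch.L k ≤ S → ((M : ℝ) ^ n k) ^ 8 * |latticeConnectedCorr r.ρ (sch.β k) (sch.side k) r.curvature.F r.curvature.F (t * M ^ n k) - latticeConnectedCorr r.ρ (sch.β k) (2 * S + 1) r.curvature.F r.curvature.F (t * M ^ n k)| ≤ ε)) ∧ ∃ Δ₁ : ℝ, 0 < Δ₁ ∧ SpeciesScheme.HasCSClustering r cn Δ₁

/-- children entry 3 (`decl_name: UltravioletLimitWithGapOnTrajectory`, kind crux), verbatim the U_gap text of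
`Cruxes/LatticeGapOnTrajectory/RESTATE-B-c9.md` (= c8's child U text + ` ∧ ∃ Δ₁ : ℝ, 0 < Δ₁ ∧ T.HasMassGap Δ₁`). -/
def UltravioletLimitWithGapOnTrajectory : Prop :=
  open Literature.MathematicalPhysics.QuantumFieldTheory Literature.MathematicalPhysics.QuantumLattice Literature.MathematicalPhysics.AQFT Classical in ∀ (G : Type) [Group G] [TopologicalSpace G] [IsTopologicalGroup G] [CompactSpace G] [MeasurableSpace G] [BorelSpace G], IsCompactSimpleLieGroup G → ∀ (r : LatticeRep G), ∃ M₀ : ℕ, ∀ M : ℕ, M₀ ≤ M → 2 ≤ M → ∃ θ₀ : ℝ, 0 < θ₀ ∧ ∀ (θ Δ : ℝ) (sch : SpeciesScheme (YMSpecies G)) (n : ℕ → ℕ), 0 < θ → θ < θ₀ → 0 < Δ → (∀ k, sch.a k = ((M : ℝ) ^ n k)⁻¹) → Filter.Tendsto sch.β Filter.atTop Filter.atTop → (∀ t : ℕ, 0 < t → ∃ c : ℝ, Filter.Tendsto (fun k => ((M : ℝ) ^ n k) ^ 8 * latticeConnectedCorr r.ρ (sch.β k) (sch.side k) r.curvature.F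 r.curvature.F (t * M ^ n k)) Filter.atTop (nhds c)) → Filter.Tendsto (fun k => ((M : ℝ) ^ n k) ^ 8 * latticeConnectedCorr r.ρ (sch.β k) (sch.side k) r.curvature.F r.curvature.F (M ^ n k)) Filter.atTop (nhds θ) → HasLatticeMassGap r sch Δ → (∃ N : ℕ, 1 ≤ N ∧ ∀ᶠ k in Filter.atTop, (sch.a k)⁻¹ ≤ (sch.a k * (sch.L k : ℝ)) ^ N) → let cn : SpeciesScheme (YMSpecies G) := { a := sch.a, a_pos := sch.a_pos, tendsto_a := sch.tendsto_a, β := sch.β, L := sch.L, tendsto_L := sch.tendsto_L, c := fun s k => if s = r.curvature then ((sch.a k) ^ 4)⁻¹ else 0, m := fun s k => wilsonTorusMean r.ρ (sch.β k) (sch.L k) s.F }; ((∀ (p : ℕ) (f : Fin p → SchwartzMap (EuclideanSpace ℝ (Fin 4)) ℝ), IsOffDiagonal (SchwartzMap.tensorFin p fun i => ofRealTest (f i)) → ∀ ε : ℝ, 0 < ε → ∀ᶠ k in Filter.atTop, ∀ L : ℕ, sch.L k ≤ L → |latticeSchwinger r.ρ cn (fun s => s.F) k p (fun _ => r.curvature)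 f - wilsonCentredSchwinger r.ρ (sch.β k) L (fun _ => 1) p (fun _ => r.curvature) (fun i => (blockDilate M)^[n k] (f i))| ≤ ε) ∧ (∀ t : ℕ, 0 < t → ∀ ε : ℝ, 0 < ε → ∀ᶠ k in Filter.atTop, ∀ S : ℕ, sch.L k ≤ S → ((M : ℝ) ^ n k) ^ 8 * |latticeConnectedCorr r.ρ (sch.β k) (sch.side k) r.curvature.F r.curvature.F (t * M ^ n k) - latticeConnectedCorr r.ρ (sch.β k) (2 * S + 1) r.curvature.F r.curvature.F (t * M ^ n k)| ≤ ε)) → (∃ Δ₁ : ℝ, 0 < Δ₁ ∧ SpeciesScheme.HasCSClustering r cn Δ₁) → ∃ sch' : SpeciesScheme (YMSpecies G), sch'.a = sch.a ∧ sch'.β = sch.β ∧ sch'.L = sch.L ∧ ∃ T : OSData (YMSpecies G) 4, IsYangMillsFor r sch' T ∧ T.IsNontrivial r.curvature ∧ T.IsNonGaussian r.curvature ∧ ∃ Δ₁ : ℝ, 0 < Δ₁ ∧ T.HasMassGap Δ₁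

end Child

/-- The route-item rendering of child V is the registered stub statement (definitional). -/
theorem child_forcedVolumeGrowth_iff : Child.ForcedVolumeGrowth ↔ ForcedVolumeGrowth := Iff.rfl

/-- The route-item rendering of child I is the registered stub statement (definitional). -/
theorem child_clusteringOnTrajectory_iff : Child.ClusteringOnTrajectory ↔ ClusteringOnTrajectory := Iff.rfl

/-- The route-item rendering of child U_gap is the registered stub statement (definitional). -/
theorem child_ultravioletLimitWithGapOnTrajectory_iff :
    Child.UltravioletLimitWithGapOnTrajectory ↔ TrisectionGap.UltravioletLimitWithGapOnTrajectory := Iff.rfl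

/-- The split glue in route-item currency: `ContinuumLimitOnTrajectory_of` typechecks against the children one-liners as they
stand (what `--glue-by` must match, up to unfolding). -/
theorem child_glue :
    Child.ForcedVolumeGrowth → Child.ClusteringOnTrajectory → Child.UltravioletLimitWithGapOnTrajectory →
      ContinuumLimitOnTrajectory :=
  ContinuumLimitOnTrajectory_of

end Summit.QuantumFields.YangMills.Cruxes.ContinuumLimitOnTrajectory.RegimeTrisection

end
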